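import Summits.QuantumFields.YangMills.Theorems.F4SubCurvatureDoorMirrorContinuation
import Literature.Analysis.Complex.CrossTheoremNStrips
import Mathlib
import HarnessLib

/-!
# Route `F4SubCurvatureDoor`, crux ⟨stmt-QuantumFields-23125⟩ `RationalToGeneral` / parent ⟨23035⟩ `ShortRootRigidity`:
# LINE g16-A «GLOBAL REDUCTION», obligation C1 `JointAnalyticityOffMirrors` — part 2/2: PROVED (`jointAnalyticityOffMirrors`)

The route owner's files-only skeleton `HOME ym-idea-3/l16/GlobalReduction.lean` (planner `ym-idea-3` g16) reduces `ShortRootRigidity`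
to `JointAnalyticityOffMirrors → GermToGlobal → GlobalShortRootRigidity`; `GermToGlobal` (C2) is the tree theorem
`F4SubCurvatureDoorGlobalReduction.germToGlobal` (p679234).  This file lands obligation C1 with the Prop SPELLED OUT (no new
definitions): a kernel `K : ℝ⁴ → ℝ` continuous off `0`, bounded outside the unit ball, invariant under the signed permutations
`W(B₄)` (`IsSignedPerm`) and reflection positive across `x₀ = 0` (point masses at positive times, `timeReflection`) is JOINTLY
REAL-ANALYTIC on the open orthants `{∀ i, xᵢ ≠ 0}` (`jointAnalyticityOffMirrors`).

Assembly of three tree theorems, as planned by the owner: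
* §1–§2: `W(B₄)` contains the total inversion, every coordinate mirror `θ_k = ((ℝ ∙ e_k)ᗮ).reflection` and the swaps `(0 k)`
  (`LinearIsometryEquiv.piLpCongrLeft`), so `K` is even, `θ_k`-invariant and — transporting the `x₀`-positivity by the swap and using
  `isMirrorRPKernel_neg_arg_iff` — reflection positive for EVERY coordinate mirror in the tree's `IsMirrorRPKernel` form; continuity off
  `0` plus the bound outside the unit ball give the half-space bounds; hence `IsMirrorRPKernel.exists_halfPlane_continuation`
  (Osterwalder–Schrader / Bernstein–Widder, `MirrorRPHalfPlaneContinuation.lean`) continues every coordinate slice `t ↦ K(t e_k + v)`,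
  `v ⊥ e_k`, holomorphically to `{Re t > 0}` with `‖F t‖ ≤ K((Re t) e_k)` (`coordinate_continuation`);
* §3: at `x` off the mirrors with margin `ℓ = ½ min |xᵢ|`, every coordinate slice through the cube of side `ℓ` is the trace of a function
  holomorphic on `ball 0 ℓ ⊂ ℂ` (`s ↦ F(x_k + s)`, resp. `F(−x_k − s)` by evenness), all bounded by the supremum `M` of `|K|` on the
  compact annulus `{ℓ ≤ ‖y‖ ≤ ‖x‖ + 4ℓ}`; Siciak's cross theorem `exists_holomorphic_extension_of_separately_local_fintype`
  (`CrossTheoremNStrips.lean`) gives one holomorphic `G` on a polydisc, and the chart lemma `analyticAt_of_holomorphic_chart_fintype`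
  (basis `EuclideanSpace.basisFun`) gives `AnalyticAt ℝ K x`.

Mathlib + tree Literature only; THEOREMS ONLY; no `sorry`; standard axioms.  HONEST FRAMING: a support lemma toward the OPEN crux
23125 / 23035 (`--supports stmt-QuantumFields-23125`); obligation C3 `GlobalShortRootRigidity` (THE WALL) is untouched; no crux, rung
of LADDER-YM (`BalabanLadder.ROT`) or mass-gap statement is proved.  Width seat `ym-line-sfw-p2-w4` g19 (cell ym-idea-1, free hands).
[cite: GlimmJaffeQP1987, §6.1 Thm. 6.1.3] [cite: JarnickiPflug2011, Ch. 5]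
-/

set_option autoImplicit false

noncomputable section

namespace Summit.QuantumFields.YangMills.Theorems.F4SubCurvatureDoorGlobalReduction

open scoped Topology InnerProductSpace
open Filter Set Metric
open Literature.MathematicalPhysics.QuantumLattice (timeReflection timeReflection_apply)
open Literature.MathematicalPhysics.QuantumFieldTheory (IsMirrorRPKernel isMirrorRPKernel_neg_arg_iff)
open Summit.QuantumFields.YangMills.Cruxes.OSLegsAtWeakCouplingC.Sketch (IsSignedPerm)

/-! ## §3 Joint real-analyticity off the mirrors -/

section Main

/-- **Obligation C1 `JointAnalyticityOffMirrors` of LINE g16-A, spelled out**: a kernel `K : ℝ⁴ → ℝ` continuous off `0`,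
bounded outside the unit ball, invariant under the signed permutations `W(B₄)` and reflection positive across `x₀ = 0` is jointly
real-analytic on the open orthants `{∀ i, xᵢ ≠ 0}`.  Osterwalder–Schrader holomorphy in each coordinate separately
(`IsMirrorRPKernel.exists_halfPlane_continuation`, transported to every mirror by `W(B₄)`), Siciak's cross theorem
(`exists_holomorphic_extension_of_separately_local_fintype`) and the real-analytic chart lemma
(`analyticAt_of_holomorphic_chart_fintype`). [cite: GlimmJaffeQP1987, §6.1 Thm. 6.1.3] [cite: JarnickiPflug2011, Ch. 5] -/
theorem jointAnalyticityOffMirrors : ∀ K : EuclideanSpace ℝ (Fin 4) → ℝ,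
    ContinuousOn K {x | x ≠ 0} →
    (∃ C : ℝ, ∀ x, 1 ≤ ‖x‖ → |K x| ≤ C) →
    (∀ R : EuclideanSpace ℝ (Fin 4) ≃ₗᵢ[ℝ] EuclideanSpace ℝ (Fin 4), IsSignedPerm R → ∀ x, K (R x) = K x) →
    (∀ (m : ℕ) (x : Fin m → EuclideanSpace ℝ (Fin 4)) (c : Fin m → ℝ), (∀ i, 0 < x i 0) →
        0 ≤ ∑ i, ∑ j, c i * c j * K (timeReflection 4 (x i) - x j)) →
    AnalyticOnNhd ℝ K {x | ∀ i, x i ≠ 0} := by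
  intro K hK hbd hB hRP x hx
  have hx' : ∀ i, x i ≠ 0 := hx
  have heven : ∀ z, K (-z) = K z := even_of_signedPerm hB
  -- a coordinate is bounded by the Euclidean norm
  have habs : ∀ (y : EuclideanSpace ℝ (Fin 4)) (i : Fin 4), |y i| ≤ ‖y‖ := by
    intro y i
    rw [EuclideanSpace.norm_eq, ← Real.sqrt_sq_eq_abs]
    refine Real.sqrt_le_sqrt ?_
    have := Finset.single_le_sum (f := fun k : Fin 4 => ‖y k‖ ^ 2) (fun k _ => sq_nonneg _) (Finset.mem_univ i)
    simpa using this
  -- the margin `ℓ`: half the distance to the nearest mirror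
  set m : ℝ := Finset.univ.inf' Finset.univ_nonempty (fun i : Fin 4 => |x i|) with hm
  have hm0 : 0 < m := (Finset.lt_inf'_iff _).2 fun i _ => abs_pos.2 (hx' i)
  have hmle : ∀ i, m ≤ |x i| := fun i => Finset.inf'_le _ (Finset.mem_univ i)
  set ℓ : ℝ := m / 2 with hℓ_def
  have hℓ : 0 < ℓ := by positivity
  have hℓm : ∀ i, 2 * ℓ ≤ |x i| := fun i => by rw [hℓ_def]; linarith [hmle i]
  -- a compact annulus carrying all the points that occur, and the bound `M` of `K` on it
  set A : Set (EuclideanSpace ℝ (Fin 4)) := {y | ℓ ≤ ‖y‖} ∩ Metric.closedBall 0 (‖x‖ + 4 * ℓ) with hA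
  have hAc : IsCompact A :=
    (isCompact_closedBall (0 : EuclideanSpace ℝ (Fin 4)) _).of_isClosed_subset
      ((isClosed_le continuous_const continuous_norm).inter Metric.isClosed_closedBall) Set.inter_subset_right
  have hA0 : A ⊆ {y | y ≠ 0} := by
    intro y hy h0
    have h1 : ℓ ≤ ‖y‖ := hy.1
    rw [h0, norm_zero] at h1
    linarith
  obtain ⟨M₀, hM₀⟩ := hAc.exists_bound_of_continuousOn (hK.mono hA0)
  set M : ℝ := max M₀ 0 with hM
  have hmemA : ∀ y : EuclideanSpace ℝ (Fin 4), ℓ ≤ ‖y‖ → ‖y‖ ≤ ‖x‖ + 4 * ℓ → y ∈ A := fun y h1 h2 =>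
    ⟨h1, by rwa [Metric.mem_closedBall, dist_zero_right]⟩
  have hMA : ∀ y : EuclideanSpace ℝ (Fin 4), ℓ ≤ ‖y‖ → ‖y‖ ≤ ‖x‖ + 4 * ℓ → |K y| ≤ M := by
    intro y h1 h2
    have := hM₀ y (hmemA y h1 h2)
    rw [Real.norm_eq_abs] at this
    exact this.trans (le_max_left _ _)
  -- axis points `τ e_k` with `|τ| ∈ [|x_k| − ℓ, |x_k| + ℓ]` lie in the annulus
  have haxis : ∀ (k : Fin 4) (τ : ℝ), |x k| - ℓ ≤ |τ| → |τ| ≤ |x k| + ℓ →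
      |K (τ • (EuclideanSpace.single k (1 : ℝ) : EuclideanSpace ℝ (Fin 4)))| ≤ M := by
    intro k τ h1 h2
    have hn : ‖τ • (EuclideanSpace.single k (1 : ℝ) : EuclideanSpace ℝ (Fin 4))‖ = |τ| := by
      rw [norm_smul, norm_single_one, mul_one, Real.norm_eq_abs]
    refine hMA _ ?_ ?_
    · rw [hn]; linarith [hℓm k]
    · rw [hn]; linarith [habs x k]
  -- the radius of the cross theorem
  obtain ⟨r, hr, hcross⟩ :=
    Literature.Analysis.Complex.exists_holomorphic_extension_of_separately_local_fintype (ι := Fin 4) ℓ hℓ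
  -- the restriction of `K` to the coordinate chart at `x`
  set e : Fin 4 → EuclideanSpace ℝ (Fin 4) := fun k => EuclideanSpace.single k (1 : ℝ) with he
  set P : (Fin 4 → ℝ) → ℂ := fun t => ((K (x + ∑ k, t k • e k) : ℝ) : ℂ) with hP
  have hcoord : ∀ (t : Fin 4 → ℝ) (i : Fin 4), (x + ∑ k, t k • e k) i = x i + t i := by
    intro t i
    rw [← inner_single_one_right (x + ∑ k, t k • e k) i, inner_add_left, sum_inner, inner_single_one_right]
    simp [real_inner_smul_left, inner_single_one_right, he, PiLp.single_apply, Finset.sum_ite_eq]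
  have hnorm : ∀ t : Fin 4 → ℝ, (∀ k, |t k| < ℓ) → ℓ ≤ ‖x + ∑ k, t k • e k‖ ∧ ‖x + ∑ k, t k • e k‖ ≤ ‖x‖ + 4 * ℓ := by
    intro t ht
    constructor
    · have h0 := habs (x + ∑ k, t k • e k) 0
      rw [hcoord] at h0
      have h1 : |x 0| ≤ |x 0 + t 0| + |t 0| := by
        have := abs_sub (x 0 + t 0) (t 0); rwa [add_sub_cancel_right] at this
      linarith [hℓm 0, ht 0]
    · have h1 : ‖∑ k, t k • e k‖ ≤ ∑ k : Fin 4, ℓ := by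
        refine (norm_sum_le _ _).trans (Finset.sum_le_sum fun k _ => ?_)
        rw [norm_smul, he, norm_single_one, mul_one, Real.norm_eq_abs]
        exact (ht k).le
      have h2 : ∑ _k : Fin 4, ℓ = 4 * ℓ := by simp
      linarith [norm_add_le x (∑ k, t k • e k)]
  have hPbound : ∀ t : Fin 4 → ℝ, (∀ k, |t k| < ℓ) → ‖P t‖ ≤ M := by
    intro t ht
    rw [hP]
    dsimp only
    rw [Complex.norm_real, Real.norm_eq_abs]
    exact hMA _ (hnorm t ht).1 (hnorm t ht).2
  -- the slices are traces of bounded holomorphic functions on `ball 0 ℓ`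
  have hslice : ∀ (k : Fin 4) (y : Fin 4 → ℝ), (∀ j, |y j| < ℓ) → ∃ g : ℂ → ℂ,
      DifferentiableOn ℂ g (Metric.ball (0 : ℂ) ℓ) ∧ (∀ w ∈ Metric.ball (0 : ℂ) ℓ, ‖g w‖ ≤ M) ∧
      ∀ t : ℝ, |t| < ℓ → g t = P (Function.update y k t) := by
    intro k y hy
    -- the transverse part of the slice through `x + Σ y_j e_j` in direction `e_k`
    set v : EuclideanSpace ℝ (Fin 4) := x + ∑ j, y j • e j - (x k + y k) • e k with hv
    have hvk : v k = 0 := by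
      rw [hv]
      have := hcoord y k
      simp only [PiLp.sub_apply, PiLp.smul_apply, smul_eq_mul] at this ⊢
      rw [this, he]; simp
    have hslicept : ∀ t : ℝ, x + ∑ j, (Function.update y k t) j • e j = (x k + t) • e k + v := by
      intro t
      ext i
      rw [hcoord]
      have hvi : v i = x i + y i - (x k + y k) * (e k) i := by
        rw [hv]
        have := hcoord y i
        simp only [PiLp.sub_apply, PiLp.smul_apply, smul_eq_mul] at this ⊢
        rw [this]
      simp only [PiLp.add_apply, PiLp.smul_apply, smul_eq_mul, hvi, he, PiLp.single_apply]
      by_cases hik : i = k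
      · subst hik; simp
      · simp [hik]
    have hreal : ∀ t : ℝ, P (Function.update y k t) = ((K ((x k + t) • e k + v) : ℝ) : ℂ) := by
      intro t; rw [hP]; dsimp only; rw [hslicept]
    -- the two half-plane continuations (for `v` and for `−v`)
    obtain ⟨F, hFd, hFr, hFb⟩ := coordinate_continuation hK hbd hB hRP k hvk
    have hvk' : (-v) k = 0 := by simp [hvk]
    obtain ⟨F', hF'd, hF'r, hF'b⟩ := coordinate_continuation hK hbd hB hRP k hvk'
    have hre : ∀ s : ℂ, ‖s‖ < ℓ → |s.re| < ℓ := fun s hs => (Complex.abs_re_le_norm s).trans_lt hs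
    rcases lt_or_gt_of_ne (hx' k) with hneg | hpos
    · -- `x_k < 0`: by evenness the slice is `t ↦ K((−x_k − t) e_k − v)`, continue `F'` at `−x_k`
      have hxk : |x k| = -x k := abs_of_neg hneg
      have hk2 : 2 * ℓ ≤ -x k := by have := hℓm k; rwa [hxk] at this
      refine ⟨fun s => F' (-((x k : ℝ) : ℂ) - s), ?_, ?_, ?_⟩
      · refine hF'd.comp ((differentiableOn_const _).sub differentiableOn_id) fun s hs => ?_
        rw [Metric.mem_ball, dist_zero_right] at hs
        show 0 < (-((x k : ℝ) : ℂ) - s).re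
        rw [Complex.sub_re, Complex.neg_re, Complex.ofReal_re]
        linarith [abs_lt.1 (hre s hs)]
      · intro s hs
        rw [Metric.mem_ball, dist_zero_right] at hs
        have hs' := abs_lt.1 (hre s hs)
        have hsre : 0 < (-((x k : ℝ) : ℂ) - s).re := by
          rw [Complex.sub_re, Complex.neg_re, Complex.ofReal_re]
          linarith
        refine (hF'b _ hsre).trans ((le_abs_self _).trans (haxis k _ ?_ ?_))
        · rw [Complex.sub_re, Complex.neg_re, Complex.ofReal_re, hxk, abs_of_pos (by linarith)]
          linarith
        · rw [Complex.sub_re, Complex.neg_re, Complex.ofReal_re, hxk, abs_of_pos (by linarith)]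
          linarith
      · intro t ht
        have hpos' : 0 < -x k - t := by linarith [abs_lt.1 ht]
        have h1 : (-((x k : ℝ) : ℂ) - (t : ℂ)) = (((-x k - t : ℝ)) : ℂ) := by push_cast; ring
        show F' (-((x k : ℝ) : ℂ) - (t : ℂ)) = P (Function.update y k t)
        rw [h1, hF'r _ hpos', hreal, ← heven ((x k + t) • e k + v)]
        congr 2
        rw [show (-x k - t : ℝ) = -(x k + t) by ring, neg_smul, neg_add, he]
    · -- `x_k > 0`: continue `F` at `x_k`
      have hxk : |x k| = x k := abs_of_pos hpos
      have hk2 : 2 * ℓ ≤ x k := by have := hℓm k; rwa [hxk] at this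
      refine ⟨fun s => F (((x k : ℝ) : ℂ) + s), ?_, ?_, ?_⟩
      · refine hFd.comp ((differentiableOn_const _).add differentiableOn_id) fun s hs => ?_
        rw [Metric.mem_ball, dist_zero_right] at hs
        show 0 < (((x k : ℝ) : ℂ) + s).re
        rw [Complex.add_re, Complex.ofReal_re]
        linarith [abs_lt.1 (hre s hs)]
      · intro s hs
        rw [Metric.mem_ball, dist_zero_right] at hs
        have hs' := abs_lt.1 (hre s hs)
        have hsre : 0 < (((x k : ℝ) : ℂ) + s).re := by
          rw [Complex.add_re, Complex.ofReal_re]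
          linarith
        refine (hFb _ hsre).trans ((le_abs_self _).trans (haxis k _ ?_ ?_))
        · rw [Complex.add_re, Complex.ofReal_re, hxk, abs_of_pos (by linarith)]
          linarith
        · rw [Complex.add_re, Complex.ofReal_re, hxk, abs_of_pos (by linarith)]
          linarith
      · intro t ht
        have hpos' : 0 < x k + t := by linarith [abs_lt.1 ht]
        have h1 : (((x k : ℝ) : ℂ) + (t : ℂ)) = (((x k + t : ℝ)) : ℂ) := by push_cast; ring
        show F (((x k : ℝ) : ℂ) + (t : ℂ)) = P (Function.update y k t)
        rw [h1, hFr _ hpos', hreal, he]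
  -- the cross theorem and the chart lemma
  obtain ⟨G, hGd, _, hGr⟩ := hcross M P hPbound hslice
  have hb : ∀ k, ((EuclideanSpace.basisFun (Fin 4) ℝ).toBasis k : EuclideanSpace ℝ (Fin 4)) = e k := fun k => by
    rw [OrthonormalBasis.coe_toBasis, EuclideanSpace.basisFun_apply]
  refine Literature.Analysis.Complex.analyticAt_of_holomorphic_chart_fintype (EuclideanSpace.basisFun (Fin 4) ℝ).toBasis
    hr hGd fun t ht => ?_
  rw [hGr t ht, hP]
  simp only [hb]

end Main

end Summit.QuantumFields.YangMills.Theorems.F4SubCurvatureDoorGlobalReduction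

end
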